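import Literature.Computability.AlgebraicComplexity.AlderStrassenRank
import HarnessLib

/-!
# Alder–Strassen `R(A) ≥ 2 dim A − t(A)`: proofs

Topic `Literature/Computability/AlgebraicComplexity`. Sibling proof file of `AlderStrassenRank.lean`:
it discharges the named fact `Literature.Computability.AlgebraicComplexity.AlderStrassen1981_rank`
— for a finite-dimensional unital associative algebra `A` over a field `k` with exactly `t(A)`
maximal two-sided ideals and any basis `b`, `2 · dim_k A ≤ R(structureTensor b) + t(A)`
(A. Alder, V. Strassen 1981; P. Bürgisser, M. Clausen, M. A. Shokrollahi, *Algebraic Complexity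
Theory* (1997), Thm. (17.14) with (14.8)) — as `AlderStrassen1981_rank_holds`, sorry-free.
Everything here is **proved**; no new named facts.

## The printed proof and what is formalised

BCS prove Thm. (17.14) for the multiplicative complexity `L(A)` (quadratic computations); the
rank form follows from `L ≤ R` (14.8). We run the printed proof of §17.2 (pp. 495–500) verbatim
for *bilinear* computations (BCS Def. (14.7); every bilinear computation is a quadratic one, and
for them the interchanging of `f_ρ` with `g_ρ` in Notation (17.15) becomes a partition of the index
set into forms on `U` and forms on `V`), which yields the rank bound directly:

* `BilComp φ P`, `HasBilComp φ r` — bilinear computations (Def. (14.7)) and "`R(φ) ≤ r`";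
  `hasBilComp_of_structureTensor` — a decomposition of the structure tensor (the tree's
  `structureTensor`, `tensorRank`) into `R` triads is a bilinear computation of length `R`
  (Def. (14.17)–(14.18): the isomorphism bilinear maps ↔ tensors is rank preserving).
* `BilComp.Sep` — separable triples `(U₁, V₁, W₁) ∈ S(φ, γ)` (Notation (17.15)), Rem. (17.16);
  `exists_isCompl_ker` — Rem. (17.3) (separating forms contain a dual basis; their zero set is a
  complement); `BilComp.exists_reduced` — Lemma (17.17) in the form used: after projecting onto
  the complements, the computation modulo `W₁` uses only `|P| − dim U₁ − dim V₁ − #{ρ | w_ρ ∈ W₁}`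
  indices; `BilComp.extend`, `BilComp.sep_of_forall(_right)` — the Extension Lemma (17.18) and the
  way it is applied ("let `U₂` be a maximal subspace such that … ; the extension lemma implies …,
  a contradiction").
* `sep_bot_top`, `sep_pow`, `hasBilComp_quotient` — Prop. (17.20)(1) (`(Rad A^i, Rad A, 0)` is
  separable, by reverse induction) and Cor. (17.21) `R(A) ≥ R(A/N) + 2 dim N` for a nilpotent
  two-sided ideal `N` (applied to `N = Rad A`, nilpotent by Fact (17.19)(2) = Mathlib's
  `IsSemiprimaryRing` for the Artinian ring `A`).
* `SimpleData` — the content of Fact (17.8) used for a simple factor (`L₁ ⊕ L₂ = A` with `L₁` a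
  minimal and `L₂` a complementary left ideal, `dim aA ≥ dim L₁` for `a ≠ 0`, and (17.8)(4));
  `matrixSimpleData` — its verification for `Mat_d(D)`, `D` a division algebra (first columns /
  vanishing first column; `fact4_of_isSimpleRing`); `SimpleData.sep_top` — the proof of
  Prop. (17.22) (`(A, 0, W₁)`, `R = (τ W₁ : L₁)`, `(R, L₂, W₁)`, `(A, L₂, W₁)` separable);
  `hasBilComp_snd` — Prop. (17.23) `R(A × B) ≥ 2 dim A − 1 + R(B)` for simple `A`
  (the computation `γ̃ = (f_ρ ∘ ι, g_ρ ∘ ι, pr₁ w_ρ)`, the projection `π` onto `L₂ × B` along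
  `kw₁ + ⋯ + kw_m`, and `ψ/(A×0)×(L₂×0) ≅` multiplication of `B`).
* `main_pi` — the proof of Thm. (17.14) for `A/Rad A ≅ ∏_{i<t} Mat_{d_i}(D_i)` (Wedderburn–Artin,
  Mathlib's `IsSemisimpleRing.exists_algEquiv_pi_matrix_divisionRing_finite`; Fact (17.19)(4)) by
  induction on the number of factors ("by Prop. (17.23) using induction"), peeling one factor with
  `piFinSuccAlgEquiv`.
* `card_coatoms_eq` — Fact (17.19)(3) and the parenthesis on p. 495 ("`t` … necessarily equals
  the number of maximal two-sided ideals of `A`"): for a surjection `A → ∏_{i<s} B_i` onto simple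
  rings with nil kernel, the maximal two-sided ideals of `A` are exactly the `s` kernels of the
  projections, so `numMaximalTwoSidedIdeals A = s`.
* `AlderStrassen1981_rank_holds` — assembly: `2 dim A = 2 dim Rad A + 2 dim A/Rad A
  ≤ (R − r₁) + (r₁ + t) = R + t`.

Deviations from the printed text: none in substance; the abstract simple algebra of Prop. (17.22)
is replaced by the concrete Wedderburn factor `Mat_d(D)` (where Fact (17.8) is verified by hand:
minimal left ideal = a column `≅ D^d`, and every non-zero right ideal `aA` contains a row space
`≅ D^d`), and quotient bilinear maps `φ/U₁×V₁` (Lemma (17.17)) are only ever formed in the two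
instances the proof needs (`A → A/N` and `A × B → B`), as explicit computations.

## References

* A. Alder, V. Strassen, *On the algorithmic complexity of associative algebras*, Theoret. Comput.
  Sci. 15 (1981) 201–211. [AlderStrassen1981]
* P. Bürgisser, M. Clausen, M. A. Shokrollahi, *Algebraic Complexity Theory*, Grundlehren 315,
  Springer 1997 (held: `book:burgisser1997-algebraic-complexity-theory`): Def. (14.7), (14.8),
  Def. (14.17)–(14.18) (pp. 388–393); Rem. (17.3), Lemma (17.4), Fact (17.8) (pp. 487–490);
  Thm. (17.14), Notation (17.15), Rem. (17.16), Lemma (17.17), Lemma (17.18), Fact (17.19),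
  Prop. (17.20), Cor. (17.21), Prop. (17.22), Prop. (17.23) and the proof of Thm. (17.14)
  (pp. 495–500). [BurgisserClausenShokrollahi1997]
-/

noncomputable section

open scoped BigOperators
open Module

namespace Literature.Computability.AlgebraicComplexity

namespace AlderStrassen1981

universe u

variable {k : Type*} [Field k]
variable {U V W : Type*} [AddCommGroup U] [Module k U] [AddCommGroup V] [Module k V]
  [AddCommGroup W] [Module k W]

/-! ### Separating forms and complements (BCS 1997, Rem. (17.3)) -/

section Separating

variable {P : Type*}


/-- The joint evaluation `u ↦ (f_ρ(u))_{ρ ∈ S}`. [folklore] -/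
def evalMap (f : P → Module.Dual k U) (S : Finset P) : U →ₗ[k] (S → k) :=
  LinearMap.pi fun ρ : S => f ρ

/-- Components of the joint evaluation. [folklore] -/
@[simp] theorem evalMap_apply (f : P → Module.Dual k U) (S : Finset P) (u : U) (ρ : S) :
    evalMap f S u ρ = f ρ u := rfl

/-- The kernel of the joint evaluation is the common zero set of the forms. [folklore] -/
theorem mem_ker_evalMap {f : P → Module.Dual k U} {S : Finset P} {u : U} :
    u ∈ LinearMap.ker (evalMap f S) ↔ ∀ ρ ∈ S, f ρ u = 0 := by
  rw [LinearMap.mem_ker, funext_iff]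
  exact ⟨fun h ρ hρ => h ⟨ρ, hρ⟩, fun h ρ => h ρ ρ.2⟩

/-- **BCS 1997, Rem. (17.3)**: if the forms `f_ρ, ρ ∈ S` separate the points of `X`, then some
`dim X` of them restrict to a basis of `X^*`, and their common zero set is a complement of `X`.
[cite: BurgisserClausenShokrollahi1997, Rem. (17.3)] -/
theorem exists_isCompl_ker [FiniteDimensional k U] (f : P → Module.Dual k U) (S : Finset P)
    (X : Submodule k U) (hsep : ∀ u ∈ X, (∀ ρ ∈ S, f ρ u = 0) → u = 0) :
    ∃ S' : Finset P, S' ⊆ S ∧ S'.card = finrank k X ∧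
      IsCompl X (LinearMap.ker (evalMap f S')) := by
  classical
  let v : P → Module.Dual k X := fun ρ => (f ρ).domRestrict X
  obtain ⟨b, hbS, -, hspan, hli⟩ :=
    exists_linearIndepOn_extension (linearIndepOn_empty k v) (Set.empty_subset (S : Set P))
  have hbfin : b.Finite := S.finite_toSet.subset hbS
  set S' : Finset P := hbfin.toFinset with hS'def
  have hmemS' : ∀ ρ, ρ ∈ S' ↔ ρ ∈ b := fun ρ => hbfin.mem_toFinset
  have hS'b : (S' : Set P) = b := by
    ext ρ
    exact hmemS' ρ
  have hS'S : S' ⊆ S := fun ρ hρ => hbS ((hmemS' ρ).1 hρ)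
  -- the forms indexed by `S'` still separate the points of `X`
  have hsep' : ∀ u ∈ X, (∀ ρ ∈ S', f ρ u = 0) → u = 0 := by
    intro u hu h0
    refine hsep u hu fun σ hσ => ?_
    have hmem : v σ ∈ Submodule.span k (v '' b) := hspan ⟨σ, hσ, rfl⟩
    have key : ∀ ψ ∈ Submodule.span k (v '' b), ψ ⟨u, hu⟩ = 0 := by
      intro ψ hψ
      induction hψ using Submodule.span_induction with
      | mem x hx =>
        obtain ⟨ρ, hρ, rfl⟩ := hx
        exact h0 ρ ((hmemS' ρ).2 hρ)
      | zero => rfl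
      | add x y _ _ hx hy => rw [LinearMap.add_apply, hx, hy, add_zero]
      | smul c x _ hx => rw [LinearMap.smul_apply, hx, smul_zero]
    exact key _ hmem
  let F : X →ₗ[k] (S' → k) := (evalMap f S').domRestrict X
  have hF : ∀ (x : X) (ρ : S'), F x ρ = f ρ x := fun x ρ => rfl
  have hFinj : Function.Injective F := by
    intro x y hxy
    rw [← sub_eq_zero]
    have h0 : F (x - y) = 0 := by rw [map_sub, hxy, sub_self]
    ext1
    refine hsep' _ (x - y).2 fun ρ hρ => ?_
    have := congr_fun h0 ⟨ρ, hρ⟩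
    rwa [hF] at this
  have h1 : finrank k X ≤ S'.card := by
    have := LinearMap.finrank_le_finrank_of_injective hFinj
    rwa [Module.finrank_fintype_fun_eq_card, Fintype.card_coe] at this
  have hli' : LinearIndependent k (fun ρ : (S' : Set P) => v ρ) := by
    rw [hS'b]
    exact hli
  have h2 : S'.card ≤ finrank k X := by
    have := hli'.fintype_card_le_finrank
    rw [Subspace.dual_finrank_eq] at this
    simpa using this
  have hcard : S'.card = finrank k X := le_antisymm h2 h1
  have hFsurj : Function.Surjective F := by
    refine (LinearMap.injective_iff_surjective_of_finrank_eq_finrank ?_).1 hFinj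
    rw [Module.finrank_fintype_fun_eq_card, Fintype.card_coe, hcard]
  refine ⟨S', hS'S, hcard, ⟨?_, ?_⟩⟩
  · exact Submodule.disjoint_def.2 fun u hu hker => hsep' u hu (mem_ker_evalMap.1 hker)
  · rw [codisjoint_iff, Submodule.eq_top_iff']
    intro u
    obtain ⟨x, hx⟩ := hFsurj (evalMap f S' u)
    refine Submodule.mem_sup.2 ⟨x, x.2, u - x, ?_, add_sub_cancel _ _⟩
    refine mem_ker_evalMap.2 fun ρ hρ => ?_
    have := congr_fun hx ⟨ρ, hρ⟩
    rw [hF, evalMap_apply] at this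
    rw [map_sub, this, sub_self]

end Separating

/-! ### Projections along a complement -/

section Proj

variable {p q : Submodule k U}

/-- The projection of `U` onto `p` along `q` (for `U = p ⊕ q`), as an endomorphism of `U`. [folklore] -/
def proj (p q : Submodule k U) (h : IsCompl p q) : U →ₗ[k] U :=
  p.subtype ∘ₗ Submodule.projectionOnto p q h

/-- The projection lands in `p`. [folklore] -/
theorem proj_mem (h : IsCompl p q) (u : U) : proj p q h u ∈ p :=
  (Submodule.projectionOnto p q h u).2

/-- The projection fixes `p`. [folklore] -/
theorem proj_of_mem_left (h : IsCompl p q) {u : U} (hu : u ∈ p) : proj p q h u = u :=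
  congrArg Subtype.val (Submodule.projectionOnto_apply_left h ⟨u, hu⟩)

/-- The projection kills `q`. [folklore] -/
theorem proj_of_mem_right (h : IsCompl p q) {u : U} (hu : u ∈ q) : proj p q h u = 0 := by
  have := congrArg Subtype.val (Submodule.projectionOnto_apply_right h ⟨u, hu⟩)
  exact this

/-- `π u ≡ u (mod q)`. [folklore] -/
theorem proj_sub_mem (h : IsCompl p q) (u : U) : proj p q h u - u ∈ q := by
  obtain ⟨x, hx, y, hy, rfl⟩ :=
    Submodule.mem_sup.1 (show u ∈ p ⊔ q from h.sup_eq_top ▸ Submodule.mem_top)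
  rw [map_add, proj_of_mem_left h hx, proj_of_mem_right h hy, add_zero, sub_add_eq_sub_sub,
    sub_self, zero_sub]
  exact q.neg_mem hy

/-- The kernel of the projection is `q`. [folklore] -/
theorem mem_right_of_proj_eq_zero (h : IsCompl p q) {u : U} (hu : proj p q h u = 0) : u ∈ q := by
  have := proj_sub_mem h u
  rwa [hu, zero_sub, Submodule.neg_mem_iff] at this

end Proj

/-! ### Bilinear computations -/

/-- A **bilinear computation** of the bilinear map `φ : U × V → W`, indexed by the finite type `P`:
linear forms `f_ρ ∈ U^*`, `g_ρ ∈ V^*` and vectors `w_ρ ∈ W` with `φ(u, v) = ∑_ρ f_ρ(u) g_ρ(v) w_ρ`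
(BCS 1997, Def. (14.7) / (14.1) with all forms bilinear). [cite: BurgisserClausenShokrollahi1997, (14.7)] -/
structure BilComp (φ : U →ₗ[k] V →ₗ[k] W) (P : Type*) [Fintype P] where
  /-- the linear forms on the first factor -/
  f : P → Module.Dual k U
  /-- the linear forms on the second factor -/
  g : P → Module.Dual k V
  /-- the vectors -/
  w : P → W
  /-- the computation computes `φ` -/
  eq : ∀ u v, φ u v = ∑ ρ, (f ρ u * g ρ v) • w ρ

/-- `φ` has a bilinear computation of length at most `r`, i.e. `R(φ) ≤ r`. [folklore] -/
def HasBilComp (φ : U →ₗ[k] V →ₗ[k] W) (r : ℕ) : Prop :=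
  ∃ n, n ≤ r ∧ Nonempty (BilComp φ (Fin n))

variable {φ : U →ₗ[k] V →ₗ[k] W} {P : Type*} [Fintype P]

namespace BilComp

/-- Reindexing a computation along a bijection. [folklore] -/
def reindex (β : BilComp φ P) {Q : Type*} [Fintype Q] (e : P ≃ Q) : BilComp φ Q where
  f := β.f ∘ e.symm
  g := β.g ∘ e.symm
  w := β.w ∘ e.symm
  eq u v := by
    rw [β.eq]
    exact Fintype.sum_equiv e _ _ fun ρ => by simp

/-- The same computation for the flipped bilinear map. [folklore] -/
def flip (β : BilComp φ P) : BilComp φ.flip P where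
  f := β.g
  g := β.f
  w := β.w
  eq v u := by
    rw [LinearMap.flip_apply, β.eq]
    exact Finset.sum_congr rfl fun ρ _ => by rw [mul_comm]

/-- **Separable triples** (BCS 1997, Notation (17.15)), for a bilinear computation: `(U₁, V₁, W₁)`
is separable by `β` if there are disjoint index sets `S`, `T` avoiding `{ρ | w_ρ ∈ W₁}` such that
the forms `f_ρ, ρ ∈ S` separate the points of `U₁` and the forms `g_ρ, ρ ∈ T` those of `V₁`.
[cite: BurgisserClausenShokrollahi1997, (17.15)] -/
def Sep (β : BilComp φ P) (U₁ : Submodule k U) (V₁ : Submodule k V) (W₁ : Submodule k W) :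
    Prop :=
  ∃ S T : Finset P, Disjoint S T ∧ (∀ ρ ∈ S, β.w ρ ∉ W₁) ∧ (∀ ρ ∈ T, β.w ρ ∉ W₁) ∧
    (∀ u ∈ U₁, (∀ ρ ∈ S, β.f ρ u = 0) → u = 0) ∧ (∀ v ∈ V₁, (∀ ρ ∈ T, β.g ρ v = 0) → v = 0)

/-- BCS 1997, Rem. (17.16)(2): separability is inherited by smaller triples.
[cite: BurgisserClausenShokrollahi1997, Rem. (17.16)(2)] -/
theorem Sep.mono {β : BilComp φ P} {U₁ U₂ : Submodule k U} {V₁ V₂ : Submodule k V}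
    {W₁ W₂ : Submodule k W} (h : β.Sep U₁ V₁ W₁) (hU : U₂ ≤ U₁) (hV : V₂ ≤ V₁)
    (hW : W₂ ≤ W₁) : β.Sep U₂ V₂ W₂ := by
  obtain ⟨S, T, hST, hSW, hTW, hSU, hTV⟩ := h
  exact ⟨S, T, hST, fun ρ hρ hw => hSW ρ hρ (hW hw), fun ρ hρ hw => hTW ρ hρ (hW hw),
    fun u hu h0 => hSU u (hU hu) h0, fun v hv h0 => hTV v (hV hv) h0⟩

/-- BCS 1997, Rem. (17.16)(1): `(0, 0, W₁)` is separable. [cite: BurgisserClausenShokrollahi1997, Rem. (17.16)(1)] -/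
theorem sep_bot_bot (β : BilComp φ P) (W₁ : Submodule k W) : β.Sep ⊥ ⊥ W₁ :=
  ⟨∅, ∅, disjoint_bot_left, by simp, by simp, fun u hu _ => (Submodule.mem_bot k).1 hu,
    fun v hv _ => (Submodule.mem_bot k).1 hv⟩

/-- Separability is symmetric under flipping. [folklore] -/
theorem Sep.flip {β : BilComp φ P} {U₁ : Submodule k U} {V₁ : Submodule k V}
    {W₁ : Submodule k W} (h : β.Sep U₁ V₁ W₁) : β.flip.Sep V₁ U₁ W₁ := by
  obtain ⟨S, T, hST, hSW, hTW, hSU, hTV⟩ := h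
  exact ⟨T, S, hST.symm, hTW, hSW, hTV, hSU⟩


/-! ### The reduced computation (BCS 1997, Lemma (17.17)) -/

/-- **BCS 1997, Lemma (17.17), for bilinear computations.** If `(U₁, V₁, W₁)` is separable by
`β`, then, restricting to complements `E_U ⊇ ker`-type zero sets of `dim U₁` (resp. `dim V₁`) of
the separating forms (the projections `πU`, `πV` onto them along `U₁`, `V₁`), the computation of
`φ(πU u, πV v)` modulo `W₁` only uses an index set `P₀` with
`|P₀| + dim U₁ + dim V₁ + #{ρ | w_ρ ∈ W₁} ≤ |P|`. [cite: BurgisserClausenShokrollahi1997, Lemma (17.17)] -/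
theorem exists_reduced [FiniteDimensional k U] [FiniteDimensional k V] (β : BilComp φ P)
    {U₁ : Submodule k U} {V₁ : Submodule k V} {W₁ : Submodule k W} (h : β.Sep U₁ V₁ W₁) :
    ∃ (P₀ : Finset P) (πU : U →ₗ[k] U) (πV : V →ₗ[k] V),
      (∀ M : Finset P, (∀ ρ ∈ M, β.w ρ ∈ W₁) →
        P₀.card + finrank k U₁ + finrank k V₁ + M.card ≤ Fintype.card P) ∧
      (∀ u, πU u - u ∈ U₁) ∧ (∀ u ∈ U₁, πU u = 0) ∧
      (∀ v, πV v - v ∈ V₁) ∧ (∀ v ∈ V₁, πV v = 0) ∧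
      ∀ u v, φ (πU u) (πV v) - ∑ ρ ∈ P₀, (β.f ρ (πU u) * β.g ρ (πV v)) • β.w ρ ∈ W₁ := by
  classical
  obtain ⟨S, T, hST, hSW, hTW, hSU, hTV⟩ := h
  obtain ⟨S', hS'S, hS'card, hcU⟩ := exists_isCompl_ker β.f S U₁ hSU
  obtain ⟨T', hT'T, hT'card, hcV⟩ := exists_isCompl_ker β.g T V₁ hTV
  set EU := LinearMap.ker (evalMap β.f S')
  set EV := LinearMap.ker (evalMap β.g T')
  set P' : Finset P := Finset.univ.filter fun ρ => β.w ρ ∉ W₁ with hP'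
  refine ⟨P' \ (S' ∪ T'), proj EU U₁ hcU.symm, proj EV V₁ hcV.symm, ?_, fun u => proj_sub_mem _ u,
    fun u hu => proj_of_mem_right _ hu, fun v => proj_sub_mem _ v,
    fun v hv => proj_of_mem_right _ hv, fun u v => ?_⟩
  · intro M hM
    have hS'P : S' ⊆ P' := fun ρ hρ =>
      Finset.mem_filter.2 ⟨Finset.mem_univ _, hSW ρ (hS'S hρ)⟩
    have hT'P : T' ⊆ P' := fun ρ hρ =>
      Finset.mem_filter.2 ⟨Finset.mem_univ _, hTW ρ (hT'T hρ)⟩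
    have hST' : Disjoint S' T' := hST.mono hS'S hT'T
    have hMP : Disjoint P' M := by
      rw [Finset.disjoint_left]
      intro ρ hρ hρM
      exact (Finset.mem_filter.1 hρ).2 (hM ρ hρM)
    have h1 : (P' \ (S' ∪ T')).card + (S' ∪ T').card = P'.card :=
      Finset.card_sdiff_add_card_eq_card (Finset.union_subset hS'P hT'P)
    have h2 : (S' ∪ T').card = S'.card + T'.card := Finset.card_union_of_disjoint hST'
    have h3 : (P' ∪ M).card = P'.card + M.card := Finset.card_union_of_disjoint hMP
    have h4 : (P' ∪ M).card ≤ Fintype.card P := Finset.card_le_univ _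
    omega
  · rw [β.eq, ← Finset.sum_sdiff (Finset.subset_univ (P' \ (S' ∪ T'))), add_sub_cancel_right]
    refine Submodule.sum_mem _ fun ρ hρ => ?_
    have hρ' : ρ ∉ P' \ (S' ∪ T') := (Finset.mem_sdiff.1 hρ).2
    by_cases hw : β.w ρ ∈ W₁
    · exact Submodule.smul_mem _ _ hw
    have hρST : ρ ∈ S' ∪ T' := by
      by_contra hn
      exact hρ' (Finset.mem_sdiff.2 ⟨Finset.mem_filter.2 ⟨Finset.mem_univ _, hw⟩, hn⟩)
    rcases Finset.mem_union.1 hρST with hρS | hρT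
    · rw [(mem_ker_evalMap.1 (proj_mem hcU.symm u)) ρ hρS, zero_mul, zero_smul]
      exact Submodule.zero_mem _
    · rw [(mem_ker_evalMap.1 (proj_mem hcV.symm v)) ρ hρT, mul_zero, zero_smul]
      exact Submodule.zero_mem _

/-! ### The extension lemma (BCS 1997, Lemma (17.18)) -/

/-- **BCS 1997, Extension Lemma (17.18), for bilinear computations** (one step): if
`(U₂, V₁, W₁)` is separable and `U₂ ⊊ U₁`, there is `u ∈ U₁ ∖ U₂` such that either
`(U₂ + ku, V₁, W₁)` is still separable, or `φ(u, V) ⊆ ⟨φ(U₁ × V₁)⟩ + W₁`.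
[cite: BurgisserClausenShokrollahi1997, Lemma (17.18)] -/
theorem extend [FiniteDimensional k U] [FiniteDimensional k V] (β : BilComp φ P)
    {U₁ U₂ : Submodule k U} {V₁ : Submodule k V} {W₁ : Submodule k W}
    (h : β.Sep U₂ V₁ W₁) (hlt : U₂ < U₁) :
    ∃ u ∈ U₁, u ∉ U₂ ∧
      (β.Sep (U₂ ⊔ k ∙ u) V₁ W₁ ∨ ∀ y, φ u y ∈ Submodule.map₂ φ U₁ V₁ ⊔ W₁) := by
  classical
  obtain ⟨S, T, hST, hSW, hTW, hSU, hTV⟩ := h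
  obtain ⟨S', hS'S, -, hcU⟩ := exists_isCompl_ker β.f S U₂ hSU
  obtain ⟨T', hT'T, -, hcV⟩ := exists_isCompl_ker β.g T V₁ hTV
  obtain ⟨x, hxU₁, hxU₂⟩ := SetLike.exists_of_lt hlt
  obtain ⟨x₂, hx₂, e, he, hxe⟩ := Submodule.mem_sup.1
    (show x ∈ U₂ ⊔ LinearMap.ker (evalMap β.f S') from hcU.sup_eq_top ▸ Submodule.mem_top)
  have hex : e = x - x₂ := by rw [← hxe]; abel
  have heU₁ : e ∈ U₁ := hex ▸ U₁.sub_mem hxU₁ (hlt.le hx₂)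
  have he0 : e ≠ 0 := by
    rintro rfl
    rw [add_zero] at hxe
    exact hxU₂ (hxe ▸ hx₂)
  have heU₂ : e ∉ U₂ := fun heU₂ => he0 (Submodule.disjoint_def.1 hcU.disjoint e heU₂ he)
  have hfe : ∀ ρ ∈ S', β.f ρ e = 0 := mem_ker_evalMap.1 he
  refine ⟨e, heU₁, heU₂, ?_⟩
  by_cases hcase : ∃ ρ, β.w ρ ∉ W₁ ∧ ρ ∉ S' ∧ ρ ∉ T' ∧ β.f ρ e ≠ 0
  · left
    obtain ⟨ρ, hρW, hρS, hρT, hρe⟩ := hcase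
    refine ⟨insert ρ S', T', ?_, ?_, fun τ hτ => hTW τ (hT'T hτ), ?_, ?_⟩
    · rw [Finset.disjoint_insert_left]
      exact ⟨hρT, hST.mono hS'S hT'T⟩
    · intro σ hσ
      rcases Finset.mem_insert.1 hσ with rfl | hσ
      · exact hρW
      · exact hSW σ (hS'S hσ)
    · intro y hy hy0
      obtain ⟨x', hx', z, hz, rfl⟩ := Submodule.mem_sup.1 hy
      obtain ⟨c, rfl⟩ := Submodule.mem_span_singleton.1 hz
      have hx'0 : x' = 0 := by
        refine Submodule.disjoint_def.1 hcU.disjoint x' hx' (mem_ker_evalMap.2 fun σ hσ => ?_)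
        have := hy0 σ (Finset.mem_insert_of_mem hσ)
        rwa [map_add, map_smul, hfe σ hσ, smul_zero, add_zero] at this
      subst hx'0
      have := hy0 ρ (Finset.mem_insert_self _ _)
      rw [zero_add, map_smul, smul_eq_mul, mul_eq_zero] at this
      rcases this with hc | hc
      · rw [hc, zero_smul, add_zero]
      · exact absurd hc hρe
    · intro v hv hv0
      exact Submodule.disjoint_def.1 hcV.disjoint v hv (mem_ker_evalMap.2 hv0)
  · right
    push Not at hcase
    intro y
    obtain ⟨y₁, hy₁, e', he', rfl⟩ := Submodule.mem_sup.1
      (show y ∈ V₁ ⊔ LinearMap.ker (evalMap β.g T') from hcV.sup_eq_top ▸ Submodule.mem_top)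
    rw [map_add]
    refine Submodule.add_mem _ (Submodule.mem_sup_left (Submodule.apply_mem_map₂ φ heU₁ hy₁))
      (Submodule.mem_sup_right ?_)
    rw [β.eq]
    refine Submodule.sum_mem _ fun ρ _ => ?_
    by_cases hw : β.w ρ ∈ W₁
    · exact Submodule.smul_mem _ _ hw
    by_cases hS : ρ ∈ S'
    · rw [hfe ρ hS, zero_mul, zero_smul]
      exact Submodule.zero_mem _
    by_cases hT : ρ ∈ T'
    · rw [(mem_ker_evalMap.1 he') ρ hT, mul_zero, zero_smul]
      exact Submodule.zero_mem _
    rw [hcase ρ hw hS hT, zero_mul, zero_smul]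
    exact Submodule.zero_mem _

/-- **The extension lemma as it is used** (BCS 1997, proofs of Prop. (17.20), (17.22)): starting
from a separable `(U₀, V₁, W₁)` with `U₀ ⊆ U₁`, take `U₂` maximal separable in between; if every
`u ∈ U₁` with `φ(u, V) ⊆ ⟨φ(U₁ × V₁)⟩ + W₁` already lies in `U₀`, then `U₂ = U₁`, i.e.
`(U₁, V₁, W₁)` is separable. [cite: BurgisserClausenShokrollahi1997, Lemma (17.18)] -/
theorem sep_of_forall [FiniteDimensional k U] [FiniteDimensional k V] (β : BilComp φ P)
    {U₀ U₁ : Submodule k U} {V₁ : Submodule k V} {W₁ : Submodule k W}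
    (h0 : β.Sep U₀ V₁ W₁) (hle : U₀ ≤ U₁)
    (hstep : ∀ u ∈ U₁, (∀ y, φ u y ∈ Submodule.map₂ φ U₁ V₁ ⊔ W₁) → u ∈ U₀) :
    β.Sep U₁ V₁ W₁ := by
  obtain ⟨U₂, ⟨h02, h21, hsep2⟩, hmax⟩ := set_has_maximal_iff_noetherian.2
    (inferInstance : IsNoetherian k U) {U' | U₀ ≤ U' ∧ U' ≤ U₁ ∧ β.Sep U' V₁ W₁}
    ⟨U₀, le_rfl, hle, h0⟩
  by_cases heq : U₂ = U₁
  · exact heq ▸ hsep2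
  obtain ⟨u, huU₁, huU₂, hor⟩ := β.extend hsep2 (lt_of_le_of_ne h21 heq)
  rcases hor with hsep' | hall
  · exfalso
    refine hmax (U₂ ⊔ k ∙ u) ⟨h02.trans le_sup_left,
      sup_le h21 ((Submodule.span_singleton_le_iff_mem _ _).2 huU₁), hsep'⟩ ?_
    refine lt_of_le_of_ne le_sup_left fun heq' => huU₂ ?_
    rw [heq']
    exact Submodule.mem_sup_right (Submodule.mem_span_singleton_self u)
  · exact absurd (h02 (hstep u huU₁ hall)) huU₂

/-- The extension lemma in the second variable ("an analogous statement holds for the roles of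
`U` and `V` interchanged", BCS 1997, Lemma (17.18)). [cite: BurgisserClausenShokrollahi1997, Lemma (17.18)] -/
theorem sep_of_forall_right [FiniteDimensional k U] [FiniteDimensional k V] (β : BilComp φ P)
    {U₁ : Submodule k U} {V₀ V₁ : Submodule k V} {W₁ : Submodule k W}
    (h0 : β.Sep U₁ V₀ W₁) (hle : V₀ ≤ V₁)
    (hstep : ∀ v ∈ V₁, (∀ x, φ x v ∈ Submodule.map₂ φ U₁ V₁ ⊔ W₁) → v ∈ V₀) :
    β.Sep U₁ V₁ W₁ := by
  have h := β.flip.sep_of_forall h0.flip hle fun v hv hall => hstep v hv fun x => by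
    have := hall x
    rwa [Submodule.map₂_flip] at this
  obtain ⟨S, T, hST, hSW, hTW, hSU, hTV⟩ := h
  exact ⟨T, S, hST.symm, hTW, hSW, hTV, hSU⟩

end BilComp

/-- A computation indexed by `P` with `|P| ≤ r` witnesses `HasBilComp φ r`. [folklore] -/
theorem hasBilComp_of_bilComp (β : BilComp φ P) {r : ℕ} (h : Fintype.card P ≤ r) :
    HasBilComp φ r :=
  ⟨Fintype.card P, h, ⟨β.reindex (Fintype.equivFin P)⟩⟩

/-! ### Associative algebras: the radical (BCS 1997, Prop. (17.20)(1), Cor. (17.21)) -/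

section Algebra

variable {A : Type*} [Ring A] [Algebra k A]

/-- Transport of a computation of the multiplication of `A` along an algebra isomorphism.
[folklore] -/
theorem HasBilComp.of_algEquiv {B : Type*} [Ring B] [Algebra k B] (e : A ≃ₐ[k] B) {r : ℕ}
    (h : HasBilComp (LinearMap.mul k A) r) : HasBilComp (LinearMap.mul k B) r := by
  obtain ⟨n, hn, ⟨β⟩⟩ := h
  refine ⟨n, hn, ⟨⟨fun ρ => β.f ρ ∘ₗ e.symm.toLinearMap, fun ρ => β.g ρ ∘ₗ e.symm.toLinearMap,
    fun ρ => e (β.w ρ), fun x y => ?_⟩⟩⟩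
  have := β.eq (e.symm x) (e.symm y)
  rw [LinearMap.mul_apply'] at this
  calc LinearMap.mul k B x y = e (e.symm x * e.symm y) := by simp
    _ = ∑ ρ, (β.f ρ (e.symm x) * β.g ρ (e.symm y)) • e (β.w ρ) := by
        rw [this, map_sum]
        exact Finset.sum_congr rfl fun ρ _ => by rw [map_smul]
    _ = _ := rfl

variable [FiniteDimensional k A]

/-- The separation lemma for the multiplication of a unital algebra: `(0, A, 0)` is separable
(BCS 1997, Rem. (17.16)(3): the multiplication is 2-concise). [cite: BurgisserClausenShokrollahi1997, Rem. (17.16)(3)] -/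
theorem sep_bot_top (β : BilComp (LinearMap.mul k A) P) : β.Sep ⊥ ⊤ ⊥ := by
  refine β.sep_of_forall_right (β.sep_bot_bot ⊥) bot_le fun b _ hb => ?_
  have := hb 1
  rwa [Submodule.map₂_bot_left, bot_sup_eq, LinearMap.mul_apply', one_mul] at this

/-- **BCS 1997, Prop. (17.20)(1)** (bilinear version): for a two-sided ideal `N` with `N^m = 0`,
the triples `(N^{m-i}, N, 0)` are separable, by reverse induction on the exponent.
[cite: BurgisserClausenShokrollahi1997, Prop. (17.20)(1)] -/
theorem sep_pow (β : BilComp (LinearMap.mul k A) P) (N : Ideal A) {m : ℕ} (hm : N ^ m = ⊥) :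
    ∀ i, i ≤ m → β.Sep ((N ^ (m - i)).restrictScalars k) (N.restrictScalars k) ⊥ := by
  intro i
  induction i with
  | zero =>
    intro _
    rw [Nat.sub_zero, hm, Submodule.restrictScalars_bot]
    exact (sep_bot_top β).mono le_rfl le_top le_rfl
  | succ i ih =>
    intro hi
    have ih' := ih (Nat.le_of_succ_le hi)
    have hmi : m - i = m - (i + 1) + 1 := by omega
    rw [hmi] at ih'
    refine β.sep_of_forall ih' ?_ fun a _ hall => ?_
    · exact fun x hx => (Ideal.pow_le_pow_right (I := N) (Nat.le_succ _)) hx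
    · have h1 := hall 1
      rw [sup_bot_eq, LinearMap.mul_apply', mul_one] at h1
      have hle : Submodule.map₂ (LinearMap.mul k A) ((N ^ (m - (i + 1))).restrictScalars k)
          (N.restrictScalars k) ≤ (N ^ (m - (i + 1) + 1)).restrictScalars k := by
        refine Submodule.map₂_le.2 fun x hx y hy => ?_
        rw [LinearMap.mul_apply', Submodule.restrictScalars_mem, Submodule.pow_succ]
        exact Ideal.mul_mem_mul hx hy
      exact hle h1

/-- **BCS 1997, Prop. (17.20)(1) ⇒ Cor. (17.21), bilinear version**: `(N, N, 0)` is separable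
for every nilpotent two-sided ideal `N`, so a computation of `A` of length `|P|` yields one of
`A/N` of length `≤ |P| − 2 dim N` (`R(A) ≥ R(A/N) + 2 dim N`).
[cite: BurgisserClausenShokrollahi1997, Cor. (17.21)] -/
theorem hasBilComp_quotient (β : BilComp (LinearMap.mul k A) P) (N : Ideal A) [N.IsTwoSided]
    (hN : IsNilpotent N) :
    ∃ r, r + 2 * finrank k (N.restrictScalars k) ≤ Fintype.card P ∧
      HasBilComp (LinearMap.mul k (A ⧸ N)) r := by
  classical
  obtain ⟨m, hm⟩ := hN
  have hsep : β.Sep (N.restrictScalars k) (N.restrictScalars k) ⊥ := by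
    have := sep_pow β N (hm.trans (Submodule.zero_eq_bot)) m le_rfl
    rw [Nat.sub_self, Submodule.pow_zero, Ideal.one_eq_top, Submodule.restrictScalars_top] at this
    exact this.mono le_top le_rfl le_rfl
  obtain ⟨P₀, πU, πV, hcount, hπU, -, hπV, -, hred⟩ := β.exists_reduced hsep
  have hc := hcount ∅ (by simp)
  simp only [Finset.card_empty, add_zero] at hc
  set q : A →ₗ[k] A ⧸ N := (Ideal.Quotient.mkₐ k N).toLinearMap with hq
  have hqsurj : Function.Surjective q := Ideal.Quotient.mkₐ_surjective k N
  obtain ⟨s, hs⟩ := q.exists_rightInverse_of_surjective (LinearMap.range_eq_top.2 hqsurj)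
  have hqs : ∀ x, q (s x) = x := fun x => LinearMap.congr_fun hs x
  have hqN : ∀ a b : A, a - b ∈ N.restrictScalars k → q a = q b := by
    intro a b hab
    rw [← sub_eq_zero, ← map_sub]
    exact (Ideal.Quotient.eq_zero_iff_mem).2 hab
  refine ⟨P₀.card, by omega, hasBilComp_of_bilComp (P := ↥P₀) ⟨fun ρ => β.f ρ ∘ₗ πU ∘ₗ s,
    fun ρ => β.g ρ ∘ₗ πV ∘ₗ s, fun ρ => q (β.w ρ), fun x y => ?_⟩ (by simp)⟩
  have hx : q (πU (s x)) = x := (hqN _ _ (hπU (s x))).trans (hqs x)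
  have hy : q (πV (s y)) = y := (hqN _ _ (hπV (s y))).trans (hqs y)
  have hr := hred (s x) (s y)
  rw [Submodule.mem_bot, sub_eq_zero, LinearMap.mul_apply'] at hr
  calc LinearMap.mul k (A ⧸ N) x y = q (πU (s x)) * q (πV (s y)) := by
        rw [LinearMap.mul_apply', hx, hy]
    _ = q (πU (s x) * πV (s y)) := (map_mul (Ideal.Quotient.mkₐ k N) _ _).symm
    _ = ∑ ρ ∈ P₀, (β.f ρ (πU (s x)) * β.g ρ (πV (s y))) • q (β.w ρ) := by
        rw [hr, map_sum]
        exact Finset.sum_congr rfl fun ρ _ => by rw [map_smul]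
    _ = _ := (Finset.sum_coe_sort P₀ _).symm

/-! ### Simple algebras (BCS 1997, Fact (17.8), Prop. (17.22), Prop. (17.23)) -/

variable (k A) in
/-- The data from **BCS 1997, Fact (17.8)** used in the proofs of Prop. (17.22)/(17.23) for a
simple algebra `A`: a (minimal) left ideal `L₁ ≠ 0` with a complementary left ideal `L₂`
(Fact (17.8)(3)), the bound `dim aA ≥ dim L₁` for every non-zero right ideal `aA`
(Fact (17.8)(1)–(2)), and Fact (17.8)(4): no non-zero left ideal `Ab` lies in a proper right ideal.
[cite: BurgisserClausenShokrollahi1997, Fact (17.8)] -/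
structure SimpleData where
  /-- a minimal left ideal -/
  L₁ : Submodule k A
  /-- a complementary left ideal -/
  L₂ : Submodule k A
  /-- `L₁` is a left ideal -/
  left₁ : ∀ a x : A, x ∈ L₁ → a * x ∈ L₁
  /-- `L₂` is a left ideal -/
  left₂ : ∀ a x : A, x ∈ L₂ → a * x ∈ L₂
  /-- `A = L₁ ⊕ L₂` (Fact (17.8)(3)) -/
  compl : IsCompl L₁ L₂
  /-- `L₁ ≠ 0` -/
  ne_bot : L₁ ≠ ⊥
  /-- every non-zero right ideal `aA` has dimension `≥ dim L₁` (Fact (17.8)(1),(2)) -/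
  rank_le : ∀ a : A, a ≠ 0 → ∀ X : Submodule k A, (∀ y, a * y ∈ X) → finrank k L₁ ≤ finrank k X
  /-- Fact (17.8)(4): a non-zero left ideal `Ab` lies in no proper right ideal -/
  fact4 : ∀ b : A, b ≠ 0 → ∀ R : Submodule k A, (∀ x ∈ R, ∀ y, x * y ∈ R) →
    (∀ x, x * b ∈ R) → R = ⊤

/-- **BCS 1997, proof of Prop. (17.22)** (bilinear version): for a simple algebra `A` with the
data of Fact (17.8), a computation `β`, and a subspace `W₁` with `dim W₁ < dim L₁` and
`W₁ ∩ L₂ = 0`, the triple `(A, L₂, W₁)` is separable — via `(A, 0, W₁)`, the proper right ideal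
`R = (τ(W₁) : L₁)`, `(R, L₂, W₁)` and finally `(A, L₂, W₁)`.
[cite: BurgisserClausenShokrollahi1997, Prop. (17.22)] -/
theorem SimpleData.sep_top (hA : SimpleData k A) (β : BilComp (LinearMap.mul k A) P)
    (W₁ : Submodule k A) (hW : finrank k W₁ < finrank k hA.L₁) (hWL : Disjoint W₁ hA.L₂) :
    β.Sep ⊤ hA.L₂ W₁ := by
  set τ := proj hA.L₁ hA.L₂ hA.compl with hτ
  -- Step 1: `(A, 0, W₁)` is separable
  have h1 : β.Sep ⊤ ⊥ W₁ := by
    refine β.sep_of_forall (β.sep_bot_bot W₁) bot_le fun a _ hall => ?_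
    by_contra ha
    have ha0 : a ≠ 0 := fun h => ha (h ▸ Submodule.zero_mem _)
    have := hA.rank_le a ha0 W₁ fun y => by
      have := hall y
      rwa [Submodule.map₂_bot_right, bot_sup_eq, LinearMap.mul_apply'] at this
    omega
  -- the proper right ideal `R = (τ W₁ : L₁)`
  let TW : Submodule k A := W₁.map τ
  have hTWle : finrank k TW ≤ finrank k W₁ := Submodule.finrank_map_le τ W₁
  let R : Submodule k A :=
    { carrier := {a | ∀ x ∈ hA.L₁, a * x ∈ TW}
      add_mem' := fun ha hb x hx => by rw [add_mul]; exact TW.add_mem (ha x hx) (hb x hx)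
      zero_mem' := fun x _ => by rw [zero_mul]; exact TW.zero_mem
      smul_mem' := fun c a ha x hx => by rw [smul_mul_assoc]; exact TW.smul_mem c (ha x hx) }
  have hRmem : ∀ a, a ∈ R ↔ ∀ x ∈ hA.L₁, a * x ∈ TW := fun a => Iff.rfl
  have hRright : ∀ a ∈ R, ∀ y, a * y ∈ R := fun a ha y => (hRmem _).2 fun x hx => by
    rw [mul_assoc]; exact (hRmem a).1 ha _ (hA.left₁ y x hx)
  have hRne : R ≠ ⊤ := by
    intro hR
    have h1R : (1 : A) ∈ R := hR ▸ Submodule.mem_top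
    have hL : hA.L₁ ≤ TW := fun x hx => by simpa using (hRmem 1).1 h1R x hx
    have := Submodule.finrank_mono hL
    omega
  -- Step 2: `(R, L₂, W₁)` is separable
  have h2 : β.Sep R hA.L₂ W₁ := by
    refine β.sep_of_forall_right (h1.mono le_top le_rfl le_rfl) bot_le fun b hb hall => ?_
    by_contra hb0'
    have hb0 : b ≠ 0 := fun h => hb0' (h ▸ Submodule.zero_mem _)
    refine hRne (hA.fact4 b hb0 R hRright fun x => ?_)
    have hx := hall x
    rw [LinearMap.mul_apply'] at hx
    obtain ⟨y, hy, w, hw, hyw⟩ := Submodule.mem_sup.1 hx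
    have hmap : Submodule.map₂ (LinearMap.mul k A) R hA.L₂ ≤ R ⊓ hA.L₂ :=
      Submodule.map₂_le.2 fun a ha l hl => ⟨hRright a ha l, hA.left₂ a l hl⟩
    obtain ⟨hyR, hyL⟩ := hmap hy
    have hw0 : w = 0 := by
      refine Submodule.disjoint_def.1 hWL w hw ?_
      have : w = x * b - y := by rw [← hyw]; abel
      rw [this]
      exact hA.L₂.sub_mem (hA.left₂ x b hb) hyL
    rw [hw0, add_zero] at hyw
    rw [← hyw]
    exact hyR
  -- Step 3: `(A, L₂, W₁)` is separable
  refine β.sep_of_forall h2 le_top fun a _ hall => (hRmem a).2 fun x hx => ?_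
  have hax := hall x
  rw [LinearMap.mul_apply'] at hax
  have hmap : Submodule.map₂ (LinearMap.mul k A) ⊤ hA.L₂ ≤ hA.L₂ :=
    Submodule.map₂_le.2 fun a _ l hl => hA.left₂ a l hl
  obtain ⟨l, hl, w, hw, hlw⟩ := Submodule.mem_sup.1 hax
  have hl' := hmap hl
  have e1 : τ (a * x) = a * x := proj_of_mem_left hA.compl (hA.left₁ a x hx)
  rw [← e1, ← hlw, map_add, proj_of_mem_right hA.compl hl', zero_add]
  exact Submodule.mem_map_of_mem hw

/-- **BCS 1997, Prop. (17.23), bilinear version**: for a simple algebra `A` (with the data of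
Fact (17.8)) and any algebra `B`, a computation of `A × B` of length `|P|` yields a computation of
`B` of length `r` with `r + 2 dim A − 1 ≤ |P|` (`R(A × B) ≥ 2 dim A − 1 + R(B)`).
[cite: BurgisserClausenShokrollahi1997, Prop. (17.23)] -/
theorem hasBilComp_snd (hA : SimpleData k A) {B : Type*} [Ring B] [Algebra k B]
    [FiniteDimensional k B] (β : BilComp (LinearMap.mul k (A × B)) P) :
    ∃ r, r + 2 * finrank k A ≤ Fintype.card P + 1 ∧ HasBilComp (LinearMap.mul k B) r := by
  classical
  set τ := proj hA.L₁ hA.L₂ hA.compl with hτ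
  set T : A × B →ₗ[k] A := τ ∘ₗ LinearMap.fst k A B with hT
  -- the `w ρ` span `A × B` (3-conciseness of the multiplication)
  have hspanw : ∀ z : A × B, z ∈ Submodule.span k (Set.range β.w) := fun z => by
    have := β.eq z 1
    rw [LinearMap.mul_apply', mul_one] at this
    rw [this]
    exact Submodule.sum_mem _ fun ρ _ => Submodule.smul_mem _ _ (Submodule.subset_span ⟨ρ, rfl⟩)
  -- hence `L₁ ⊆ ⟨T(w ρ)⟩`; choose `M` with `(T (w ρ))_{ρ ∈ M}` a basis of `L₁`
  obtain ⟨b, -, -, hbspan, hbli⟩ := exists_linearIndepOn_extension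
    (linearIndepOn_empty k (T ∘ β.w)) (Set.empty_subset (Set.univ : Set P))
  set M : Finset P := (Set.toFinite b).toFinset with hMdef
  have hM : ∀ ρ, ρ ∈ M ↔ ρ ∈ b := fun ρ => Set.Finite.mem_toFinset _
  have hMb : (M : Set P) = b := by
    ext ρ
    exact hM ρ
  have hTw : ∀ ρ, T (β.w ρ) ∈ hA.L₁ := fun ρ => proj_mem hA.compl _
  have hspan_eq : Submodule.span k ((T ∘ β.w) '' b) = hA.L₁ := by
    refine le_antisymm (Submodule.span_le.2 ?_) fun x hx => ?_
    · rintro _ ⟨ρ, _, rfl⟩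
      exact hTw ρ
    · have h1 : x = T (x, 0) := by
        simp only [hT, LinearMap.comp_apply, LinearMap.fst_apply]
        exact (proj_of_mem_left hA.compl hx).symm
      have h2 : T (x, 0) ∈ Submodule.span k (Set.range (T ∘ β.w)) := by
        rw [Set.range_comp, ← Submodule.map_span]
        exact Submodule.mem_map_of_mem (hspanw _)
      rw [h1]
      refine (Submodule.span_le.2 ?_) h2
      rintro _ ⟨ρ, rfl⟩
      exact hbspan ⟨ρ, Set.mem_univ _, rfl⟩
  have hli : LinearIndepOn k (T ∘ β.w) (M : Set P) := hMb ▸ hbli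
  have hcardM : M.card = finrank k hA.L₁ := by
    have hli' : LinearIndependent k (fun ρ : (M : Set P) => (T ∘ β.w) ρ) := hli
    have h := finrank_span_eq_card hli'
    have hr : Set.range (fun ρ : (M : Set P) => (T ∘ β.w) ρ) = (T ∘ β.w) '' b := by
      rw [← hMb, Set.image_eq_range]
    rw [hr, hspan_eq] at h
    rw [h]
    simp
  -- linear independence: `T` is injective on `⟨w ρ : ρ ∈ M⟩`
  have hzero : ∀ y ∈ Submodule.span k (β.w '' (M : Set P)), T y = 0 → y = 0 := by
    intro y hy hTy
    obtain ⟨l, hl, rfl⟩ := (Finsupp.mem_span_image_iff_linearCombination k).1 hy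
    rw [Finsupp.apply_linearCombination] at hTy
    rw [(linearIndepOn_iff.1 hli) l hl hTy, map_zero]
  -- `M` is nonempty; remove one index
  have hm1 : 1 ≤ finrank k hA.L₁ := by
    rw [Nat.one_le_iff_ne_zero, Ne, Submodule.finrank_eq_zero]
    exact hA.ne_bot
  obtain ⟨ρ₀, hρ₀⟩ : ∃ ρ₀, ρ₀ ∈ M := Finset.card_pos.1 (by omega)
  set M₀ : Finset P := M.erase ρ₀ with hM₀
  have hM₀M : (M₀ : Set P) ⊆ M := Finset.coe_subset.2 (Finset.erase_subset _ _)
  have hcardM₀ : M₀.card + 1 = M.card := Finset.card_erase_add_one hρ₀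
  set W₁ : Submodule k (A × B) := Submodule.span k (β.w '' (M₀ : Set P)) with hW₁def
  set W₁' : Submodule k (A × B) := Submodule.span k (β.w '' (M : Set P)) with hW₁'def
  have hW₁le : W₁ ≤ W₁' := Submodule.span_mono (Set.image_mono hM₀M)
  -- the computation `γ̃` of `A` induced by `β`
  let γ : BilComp (LinearMap.mul k A) P :=
    { f := fun ρ => β.f ρ ∘ₗ LinearMap.inl k A B
      g := fun ρ => β.g ρ ∘ₗ LinearMap.inl k A B
      w := fun ρ => (β.w ρ).1
      eq := fun a a' => by
        have := β.eq (a, 0) (a', 0)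
        rw [LinearMap.mul_apply', Prod.mk_mul_mk, mul_zero] at this
        have h1 : a * a' = ∑ ρ, (((β.f ρ) (a, 0) * (β.g ρ) (a', 0)) • β.w ρ).1 := by
          simpa [Prod.fst_sum] using congrArg Prod.fst this
        rw [LinearMap.mul_apply', h1]
        rfl }
  -- Prop. (17.22) for `γ̃` and `pr₁ W₁`
  set W₁A : Submodule k A := W₁.map (LinearMap.fst k A B) with hW₁A
  have hW₁A_lt : finrank k W₁A < finrank k hA.L₁ := by
    have h1 : finrank k W₁A ≤ finrank k W₁ := Submodule.finrank_map_le _ _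
    have h2 : finrank k W₁ ≤ M₀.card := by
      have := finrank_span_finset_le_card (R := k) (M₀.image β.w)
      rw [Finset.coe_image] at this
      exact this.trans Finset.card_image_le
    omega
  have hW₁A_disj : Disjoint W₁A hA.L₂ := by
    refine Submodule.disjoint_def.2 fun x hx hxL => ?_
    obtain ⟨y, hy, rfl⟩ := Submodule.mem_map.1 hx
    have hTy : T y = 0 := proj_of_mem_right hA.compl hxL
    rw [hzero y (hW₁le hy) hTy, map_zero]
  obtain ⟨S, T', hST, hSW, hTW, hSU, hTV⟩ := hA.sep_top γ W₁A hW₁A_lt hW₁A_disj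
  -- hence `(A × 0, L₂ × 0, W₁)` is separable by `β`
  have hsepβ : β.Sep ((⊤ : Submodule k A).prod (⊥ : Submodule k B))
      (hA.L₂.prod (⊥ : Submodule k B)) W₁ := by
    have hnot : ∀ ρ, γ.w ρ ∉ W₁A → β.w ρ ∉ W₁ := fun ρ h hw =>
      h (Submodule.mem_map_of_mem hw)
    refine ⟨S, T', hST, fun ρ hρ => hnot ρ (hSW ρ hρ), fun ρ hρ => hnot ρ (hTW ρ hρ), ?_, ?_⟩
    · intro z hz h0
      obtain ⟨-, hz2⟩ := Submodule.mem_prod.1 hz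
      rw [Submodule.mem_bot] at hz2
      have hz1 : z.1 = 0 := hSU z.1 Submodule.mem_top fun ρ hρ => by
        have := h0 ρ hρ
        rwa [show z = (z.1, 0) from Prod.ext rfl hz2] at this
      exact Prod.ext hz1 hz2
    · intro z hz h0
      obtain ⟨hz1', hz2⟩ := Submodule.mem_prod.1 hz
      rw [Submodule.mem_bot] at hz2
      have hz1 : z.1 = 0 := hTV z.1 hz1' fun ρ hρ => by
        have := h0 ρ hρ
        rwa [show z = (z.1, 0) from Prod.ext rfl hz2] at this
      exact Prod.ext hz1 hz2
  obtain ⟨P₀, πU, πV, hcount, hπU, -, hπV, -, hred⟩ := β.exists_reduced hsepβ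
  -- the count
  have hc := hcount M₀ fun ρ hρ => Submodule.subset_span ⟨ρ, hρ, rfl⟩
  have e1 : finrank k ((⊤ : Submodule k A).prod (⊥ : Submodule k B)) = finrank k A := by
    rw [← Submodule.map_inl, ← (Submodule.equivMapOfInjective (LinearMap.inl k A B)
      LinearMap.inl_injective ⊤).finrank_eq]
    exact finrank_top k A
  have e2 : finrank k (hA.L₂.prod (⊥ : Submodule k B)) = finrank k hA.L₂ := by
    rw [← Submodule.map_inl, ← (Submodule.equivMapOfInjective (LinearMap.inl k A B)
      LinearMap.inl_injective _).finrank_eq]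
  have e3 : finrank k hA.L₁ + finrank k hA.L₂ = finrank k A :=
    Submodule.finrank_add_eq_of_isCompl hA.compl
  rw [e1, e2] at hc
  -- the projection `κ` onto `L₂ × B` along `W₁' = ⟨w ρ : ρ ∈ M⟩`, followed by `pr₂`
  have hcW : IsCompl (hA.L₂.prod (⊤ : Submodule k B)) W₁' := by
    refine ⟨Submodule.disjoint_def.2 fun y hy hy' => ?_, ?_⟩
    · exact hzero y hy' (proj_of_mem_right hA.compl (Submodule.mem_prod.1 hy).1)
    · rw [codisjoint_iff, Submodule.eq_top_iff']
      intro z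
      have hTz : T z ∈ W₁'.map T := by
        rw [Submodule.map_span, ← Set.image_comp, hMb, hspan_eq]
        exact proj_mem hA.compl _
      obtain ⟨y, hy, hyz⟩ := Submodule.mem_map.1 hTz
      refine Submodule.mem_sup.2 ⟨z - y, ?_, y, hy, sub_add_cancel z y⟩
      refine Submodule.mem_prod.2 ⟨mem_right_of_proj_eq_zero hA.compl ?_, Submodule.mem_top⟩
      have : T (z - y) = 0 := by rw [map_sub, hyz, sub_self]
      exact this
  let κ : A × B →ₗ[k] B := LinearMap.snd k A B ∘ₗ proj _ _ hcW
  have hκ0 : ∀ y ∈ W₁', κ y = 0 := fun y hy => by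
    simp only [κ, LinearMap.comp_apply, proj_of_mem_right hcW hy, map_zero]
  have hκ1 : ∀ z ∈ hA.L₂.prod (⊤ : Submodule k B), κ z = z.2 := fun z hz => by
    simp only [κ, LinearMap.comp_apply, proj_of_mem_left hcW hz, LinearMap.snd_apply]
  -- the induced computation of `B`
  have hmain : ∀ x y : B, x * y =
      ∑ ρ ∈ P₀, (β.f ρ (πU (0, x)) * β.g ρ (πV (0, y))) • κ (β.w ρ) := by
    intro x y
    have hU := Submodule.mem_prod.1 (hπU (0, x))
    have hV := Submodule.mem_prod.1 (hπV (0, y))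
    have hU2 : (πU (0, x)).2 = x := by
      have := hU.2
      rw [Submodule.mem_bot] at this
      simpa [sub_eq_zero] using this
    have hV1 : (πV (0, y)).1 ∈ hA.L₂ := by simpa using hV.1
    have hV2 : (πV (0, y)).2 = y := by
      have := hV.2
      rw [Submodule.mem_bot] at this
      simpa [sub_eq_zero] using this
    have hprod : πU (0, x) * πV (0, y) ∈ hA.L₂.prod (⊤ : Submodule k B) :=
      Submodule.mem_prod.2 ⟨by rw [Prod.fst_mul]; exact hA.left₂ _ _ hV1, Submodule.mem_top⟩
    have h1 : κ (πU (0, x) * πV (0, y)) = x * y := by rw [hκ1 _ hprod, Prod.snd_mul, hU2, hV2]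
    have h2 := hred (0, x) (0, y)
    rw [LinearMap.mul_apply'] at h2
    have h3 := hκ0 _ (hW₁le h2)
    rw [map_sub, sub_eq_zero, h1, map_sum] at h3
    rw [h3]
    exact Finset.sum_congr rfl fun ρ _ => by rw [map_smul]
  refine ⟨P₀.card, by omega, hasBilComp_of_bilComp (P := ↥P₀)
    ⟨fun ρ => β.f ρ ∘ₗ πU ∘ₗ LinearMap.inr k A B, fun ρ => β.g ρ ∘ₗ πV ∘ₗ LinearMap.inr k A B,
      fun ρ => κ (β.w ρ), fun x y => ?_⟩ (by simp)⟩
  rw [LinearMap.mul_apply', hmain x y]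
  exact (Finset.sum_coe_sort P₀ _).symm

omit [FiniteDimensional k A] in
/-- **BCS 1997, Fact (17.8)(4)** for a simple ring: a non-zero left ideal `Ab` is contained in no
proper right ideal (here: `k`-subspace closed under right multiplication).
[cite: BurgisserClausenShokrollahi1997, Fact (17.8)(4)] -/
theorem fact4_of_isSimpleRing [IsSimpleRing A] (b : A) (hb : b ≠ 0) (R : Submodule k A)
    (hR : ∀ x ∈ R, ∀ y, x * y ∈ R) (hRb : ∀ x, x * b ∈ R) : R = ⊤ := by
  let T : TwoSidedIdeal A := TwoSidedIdeal.mk' {x | ∀ c a, c * x * a ∈ R}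
    (fun c a => by rw [mul_zero, zero_mul]; exact R.zero_mem)
    (fun hx hy c a => by rw [mul_add, add_mul]; exact R.add_mem (hx c a) (hy c a))
    (fun hx c a => by rw [mul_neg, neg_mul]; exact R.neg_mem (hx c a))
    (fun {x y} hy c a => by rw [← mul_assoc]; exact hy (c * x) a)
    (fun {x y} hx c a => by rw [← mul_assoc, mul_assoc (c * x) y a]; exact hx c (y * a))
  have hbT : b ∈ T := by
    rw [TwoSidedIdeal.mem_mk']
    intro c a
    exact hR _ (hRb c) a
  have h1 := IsSimpleRing.one_mem_of_ne_zero_mem T hb hbT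
  rw [TwoSidedIdeal.mem_mk'] at h1
  have h1R : (1 : A) ∈ R := by simpa using h1 1 1
  exact Submodule.eq_top_iff'.2 fun x => by simpa using hR 1 h1R x

end Algebra

/-! ### The simple factors `k^{d×d} ⊗ D = Mat_d(D)` (BCS 1997, Fact (17.8)) -/

section MatrixAlgebra

variable (k)
variable {D : Type*} [DivisionRing D] [Algebra k D] (d : ℕ) [NeZero d]

/-- The first-column embedding `v ↦ (v | 0 | ⋯ | 0)` of `D^d` into `Mat_d(D)`; its image is the
minimal left ideal `L₁` of first columns. [folklore] -/
def colEmb : (Fin d → D) →ₗ[k] Matrix (Fin d) (Fin d) D where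
  toFun v := Matrix.of fun i j => if j = 0 then v i else 0
  map_add' v v' := by
    ext i j
    simp only [Matrix.of_apply, Matrix.add_apply, Pi.add_apply]
    split_ifs <;> simp
  map_smul' c v := by
    ext i j
    simp only [Matrix.of_apply, Matrix.smul_apply, Pi.smul_apply, RingHom.id_apply]
    split_ifs <;> simp

/-- The first column of a matrix; its kernel is the maximal left ideal `L₂` of matrices with
vanishing first column. [folklore] -/
def col0 : Matrix (Fin d) (Fin d) D →ₗ[k] (Fin d → D) where
  toFun x i := x i 0
  map_add' _ _ := rfl
  map_smul' _ _ := rfl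

/-- Entries of the column embedding. [folklore] -/
theorem colEmb_apply (v : Fin d → D) (i j : Fin d) :
    colEmb k d v i j = if j = 0 then v i else 0 := rfl

/-- Entries of the first column. [folklore] -/
theorem col0_apply (x : Matrix (Fin d) (Fin d) D) (i : Fin d) : col0 k d x i = x i 0 := rfl

/-- The first column of `colEmb v` is `v`. [folklore] -/
theorem col0_colEmb (v : Fin d → D) : col0 k d (colEmb k d v) = v := by
  ext i
  rw [col0_apply, colEmb_apply, if_pos rfl]

/-- Left multiplication acts on first columns by the matrix–vector product (so `L₁` is a left
ideal). [folklore] -/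
theorem mul_colEmb (a : Matrix (Fin d) (Fin d) D) (v : Fin d → D) :
    a * colEmb k d v = colEmb k d (a.mulVec v) := by
  ext i j
  simp only [Matrix.mul_apply, colEmb_apply, Matrix.mulVec, dotProduct]
  split_ifs with h <;> simp

/-- Matrices with vanishing first column form a left ideal. [folklore] -/
theorem col0_mul (a x : Matrix (Fin d) (Fin d) D) (hx : col0 k d x = 0) : col0 k d (a * x) = 0 := by
  ext i
  have hx' : ∀ l, x l 0 = 0 := fun l => congr_fun hx l
  simp [col0_apply, Matrix.mul_apply, hx']

variable [Module.Finite k D]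

/-- **BCS 1997, Fact (17.8) for the simple algebra `Mat_d(D)`**, `D` a division algebra: the left
ideals `L₁` (first columns, minimal, `≅ D^d`) and `L₂` (first column zero) are complementary,
every non-zero right ideal `aA` contains a copy of a row space `≅ D^d`, and Fact (17.8)(4) holds
since `Mat_d(D)` is a simple ring. [cite: BurgisserClausenShokrollahi1997, Fact (17.8)] -/
def matrixSimpleData : SimpleData k (Matrix (Fin d) (Fin d) D) where
  L₁ := LinearMap.range (colEmb k d)
  L₂ := LinearMap.ker (col0 k d)
  left₁ a x hx := by
    obtain ⟨v, rfl⟩ := hx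
    exact ⟨a.mulVec v, (mul_colEmb k d a v).symm⟩
  left₂ a x hx := by
    rw [LinearMap.mem_ker] at hx ⊢
    exact col0_mul k d a x hx
  compl := by
    refine ⟨Submodule.disjoint_def.2 ?_, ?_⟩
    · rintro x ⟨v, rfl⟩ hx
      rw [LinearMap.mem_ker, col0_colEmb] at hx
      rw [hx, map_zero]
    · rw [codisjoint_iff, Submodule.eq_top_iff']
      intro x
      refine Submodule.mem_sup.2 ⟨colEmb k d (col0 k d x), ⟨_, rfl⟩,
        x - colEmb k d (col0 k d x), ?_, add_sub_cancel _ _⟩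
      rw [LinearMap.mem_ker, map_sub, col0_colEmb, sub_self]
  ne_bot h := by
    have hmem : colEmb k d (fun _ => (1 : D)) ∈ LinearMap.range (colEmb k d) := ⟨_, rfl⟩
    rw [h, Submodule.mem_bot] at hmem
    have := congr_fun (congr_fun hmem 0) 0
    rw [colEmb_apply, if_pos rfl] at this
    exact one_ne_zero this
  rank_le a ha X hX := by
    obtain ⟨i, j, hij⟩ : ∃ i j, a i j ≠ 0 := by
      by_contra hcon
      push Not at hcon
      exact ha (Matrix.ext hcon)
    let rowE : (Fin d → D) →ₗ[k] Matrix (Fin d) (Fin d) D :=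
      { toFun := fun y => Matrix.of fun p q => if p = j then y q else 0
        map_add' := fun y y' => by
          ext p q
          simp only [Matrix.of_apply, Matrix.add_apply, Pi.add_apply]
          split_ifs <;> simp
        map_smul' := fun c y => by
          ext p q
          simp only [Matrix.of_apply, Matrix.smul_apply, Pi.smul_apply, RingHom.id_apply]
          split_ifs <;> simp }
    have hrowE : ∀ y p q, rowE y p q = if p = j then y q else 0 := fun y p q => rfl
    have hrow : ∀ y p q, (a * rowE y) p q = a p j * y q := fun y p q => by
      simp only [Matrix.mul_apply, hrowE, mul_ite, mul_zero, Finset.sum_ite_eq',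
        Finset.mem_univ, if_true]
    let F : (Fin d → D) →ₗ[k] X :=
      LinearMap.codRestrict X (LinearMap.mulLeft k a ∘ₗ rowE) fun y => hX _
    have hF : Function.Injective F := by
      intro y y' hyy'
      have h : a * rowE y = a * rowE y' := congrArg Subtype.val hyy'
      funext q
      have := congr_fun (congr_fun h i) q
      rw [hrow, hrow] at this
      exact mul_left_cancel₀ hij this
    have hinj : Function.Injective (colEmb k (D := D) d) := fun v v' hv => by
      have := congrArg (col0 k d) hv
      rwa [col0_colEmb, col0_colEmb] at this
    calc finrank k (LinearMap.range (colEmb k d))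
        = finrank k (Fin d → D) := (LinearEquiv.ofInjective (colEmb k d) hinj).finrank_eq.symm
      _ ≤ finrank k X := LinearMap.finrank_le_finrank_of_injective hF
  fact4 b hb R hR hRb := fact4_of_isSimpleRing b hb R hR hRb

end MatrixAlgebra

/-! ### Products of simple algebras (BCS 1997, proof of Thm. (17.14)) -/

section Product

variable (k) in
/-- `∏_{i ≤ s} X_i ≅ X_0 × ∏_{i < s} X_{i+1}` as `k`-algebras. [folklore] -/
def piFinSuccAlgEquiv (s : ℕ) (X : Fin (s + 1) → Type*) [∀ i, Ring (X i)]
    [∀ i, Algebra k (X i)] : (∀ i, X i) ≃ₐ[k] X 0 × ∀ i : Fin s, X i.succ where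
  toFun x := (x 0, fun i => x i.succ)
  invFun p := Fin.cons p.1 p.2
  left_inv x := Fin.cons_self_tail x
  right_inv p := Prod.ext (Fin.cons_zero p.1 p.2) (funext fun i => Fin.cons_succ p.1 p.2 i)
  map_mul' _ _ := rfl
  map_add' _ _ := rfl
  commutes' _ := rfl

universe v

/-- **BCS 1997, proof of Thm. (17.14), semisimple case** (Prop. (17.23) "using induction"):
`R(∏_{i<s} Mat_{d_i}(D_i)) ≥ 2 dim − s`. [cite: BurgisserClausenShokrollahi1997, Thm. (17.14)] -/
theorem main_pi (s : ℕ) : ∀ (d : Fin s → ℕ) (D : Fin s → Type v) [∀ i, DivisionRing (D i)]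
    [∀ i, Algebra k (D i)] [∀ i, Module.Finite k (D i)], (∀ i, NeZero (d i)) → ∀ r : ℕ,
    HasBilComp (LinearMap.mul k (∀ i, Matrix (Fin (d i)) (Fin (d i)) (D i))) r →
    2 * finrank k (∀ i, Matrix (Fin (d i)) (Fin (d i)) (D i)) ≤ r + s := by
  induction s with
  | zero =>
    intro d D _ _ _ _ r _
    have := Module.finrank_zero_of_subsingleton (R := k)
      (M := ∀ i, Matrix (Fin (d i)) (Fin (d i)) (D i))
    omega
  | succ s ih =>
    intro d D _ _ _ hd r h
    haveI : ∀ i, NeZero (d i) := hd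
    obtain ⟨n, hn, ⟨β⟩⟩ := h.of_algEquiv
      (piFinSuccAlgEquiv k s fun i => Matrix (Fin (d i)) (Fin (d i)) (D i))
    obtain ⟨r', hr', h'⟩ := hasBilComp_snd (matrixSimpleData k (d 0)) β
    rw [Fintype.card_fin] at hr'
    have hih := ih (fun i => d i.succ) (fun i => D i.succ) (fun i => hd i.succ) r' h'
    have hdim : finrank k (∀ i, Matrix (Fin (d i)) (Fin (d i)) (D i)) =
        finrank k (Matrix (Fin (d 0)) (Fin (d 0)) (D 0)) +
          finrank k (∀ i : Fin s, Matrix (Fin (d i.succ)) (Fin (d i.succ)) (D i.succ)) := by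
      rw [(piFinSuccAlgEquiv k s fun i =>
        Matrix (Fin (d i)) (Fin (d i)) (D i)).toLinearEquiv.finrank_eq, Module.finrank_prod]
    omega

end Product

/-! ### Counting the maximal two-sided ideals (BCS 1997, Fact (17.19)(3),(4)) -/

section Count

variable {A : Type*} [Ring A]

/-- If `g : A → B` is a surjective ring homomorphism onto a simple ring and `I` is a two-sided
ideal containing an element outside `ker g`, then `g(I) ∋ 1`. [folklore] -/
theorem exists_mem_map_eq_one {B : Type*} [Ring B] [IsSimpleRing B] (g : A →+* B)
    (hg : Function.Surjective g) (I : TwoSidedIdeal A) {x : A} (hxI : x ∈ I) (hx : g x ≠ 0) :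
    ∃ z ∈ I, g z = 1 := by
  let K : TwoSidedIdeal B := TwoSidedIdeal.mk' (g '' I) ⟨0, I.zero_mem, map_zero g⟩
    (by
      rintro _ _ ⟨a, ha, rfl⟩ ⟨b, hb, rfl⟩
      exact ⟨a + b, I.add_mem ha hb, map_add g a b⟩)
    (by
      rintro _ ⟨a, ha, rfl⟩
      exact ⟨-a, I.neg_mem ha, map_neg g a⟩)
    (by
      rintro c _ ⟨a, ha, rfl⟩
      obtain ⟨c', rfl⟩ := hg c
      exact ⟨c' * a, I.mul_mem_left _ _ ha, map_mul g c' a⟩)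
    (by
      rintro _ c ⟨a, ha, rfl⟩
      obtain ⟨c', rfl⟩ := hg c
      exact ⟨a * c', I.mul_mem_right _ _ ha, map_mul g a c'⟩)
  have h1 : (1 : B) ∈ K := IsSimpleRing.one_mem_of_ne_zero_mem K hx
    (by rw [TwoSidedIdeal.mem_mk']; exact ⟨x, hxI, rfl⟩)
  rw [TwoSidedIdeal.mem_mk'] at h1
  obtain ⟨z, hz, hz1⟩ := h1
  exact ⟨z, hz, hz1⟩

/-- The kernel of a surjection onto a simple ring is a maximal two-sided ideal. [folklore] -/
theorem isCoatom_ker {B : Type*} [Ring B] [IsSimpleRing B] (g : A →+* B)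
    (hg : Function.Surjective g) : IsCoatom (TwoSidedIdeal.ker g) := by
  refine ⟨fun h => ?_, fun I hI => ?_⟩
  · have h1 : (1 : A) ∈ TwoSidedIdeal.ker g := by rw [h]; trivial
    rw [TwoSidedIdeal.mem_ker, map_one] at h1
    exact one_ne_zero h1
  · obtain ⟨x, hxI, hxK⟩ := Set.exists_of_ssubset ((TwoSidedIdeal.lt_iff _ _).1 hI)
    have hx : g x ≠ 0 := fun h0 => hxK ((TwoSidedIdeal.mem_ker g).2 h0)
    obtain ⟨z, hzI, hz1⟩ := exists_mem_map_eq_one g hg I hxI hx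
    rw [← TwoSidedIdeal.one_mem_iff]
    have hz' : (1 : A) - z ∈ TwoSidedIdeal.ker g := by
      rw [TwoSidedIdeal.mem_ker, map_sub, map_one, hz1, sub_self]
    have := I.add_mem (hI.le hz') hzI
    rwa [sub_add_cancel] at this

/-- **BCS 1997, Fact (17.19)(3)–(4), the count of maximal two-sided ideals**: if
`π : A → ∏_{i<s} B_i` is a surjective ring homomorphism onto a product of `s` simple rings whose
kernel is nil (e.g. `A → A/Rad A ≅ A₁ × ⋯ × A_s`), then `A` has exactly `s` maximal two-sided
ideals, namely the kernels of the `s` projections. [cite: BurgisserClausenShokrollahi1997, Fact (17.19)] -/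
theorem card_coatoms_eq {s : ℕ} {B : Fin s → Type*} [∀ i, Ring (B i)] [∀ i, IsSimpleRing (B i)]
    (π : A →+* ∀ i, B i) (hπ : Function.Surjective π) (hnil : ∀ x, π x = 0 → IsNilpotent x) :
    Nat.card {I : TwoSidedIdeal A // IsCoatom I} = s := by
  classical
  let g : ∀ i, A →+* B i := fun i => (Pi.evalRingHom B i).comp π
  have hg : ∀ i, Function.Surjective (g i) := fun i => (Function.surjective_eval i).comp hπ
  have hgapp : ∀ i x, g i x = π x i := fun i x => rfl
  let M : Fin s → {I : TwoSidedIdeal A // IsCoatom I} :=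
    fun i => ⟨TwoSidedIdeal.ker (g i), isCoatom_ker (g i) (hg i)⟩
  have hgM : ∀ i x, x ∈ (M i).1 ↔ π x i = 0 := fun i x => TwoSidedIdeal.mem_ker _
  suffices hbij : Function.Bijective M by
    rw [← Nat.card_eq_of_bijective M hbij, Nat.card_eq_fintype_card, Fintype.card_fin]
  constructor
  · intro i j hij
    by_contra hne
    obtain ⟨u, hu⟩ := hπ (Pi.single i 1)
    have h1 : u ∉ (M i).1 := by
      rw [hgM, hu, Pi.single_eq_same]
      exact one_ne_zero
    have h2 : u ∈ (M j).1 := by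
      rw [hgM, hu, Pi.single_eq_of_ne (Ne.symm hne)]
    rw [hij] at h1
    exact h1 h2
  · rintro ⟨I, hI⟩
    by_contra hnone
    push Not at hnone
    have hv : ∀ i, ∃ v ∈ I, π v = Pi.single i 1 := by
      intro i
      have hnot : ∃ x ∈ I, g i x ≠ 0 := by
        by_contra hcon
        push Not at hcon
        have hle : I ≤ TwoSidedIdeal.ker (g i) := fun x hx =>
          (TwoSidedIdeal.mem_ker _).2 (hcon x hx)
        rcases hle.lt_or_eq with hlt | heq
        · exact (isCoatom_ker (g i) (hg i)).1 (hI.2 _ hlt)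
        · exact hnone i (Subtype.ext heq.symm)
      obtain ⟨x, hxI, hx⟩ := hnot
      obtain ⟨z, hzI, hz1⟩ := exists_mem_map_eq_one (g i) (hg i) I hxI hx
      obtain ⟨u, hu⟩ := hπ (Pi.single i 1)
      refine ⟨z * u, I.mul_mem_right _ _ hzI, ?_⟩
      rw [map_mul, hu]
      ext j
      rw [Pi.mul_apply]
      by_cases hj : j = i
      · subst hj
        rw [Pi.single_eq_same, mul_one]
        exact hz1
      · rw [Pi.single_eq_of_ne hj, mul_zero]
    choose v hvI hvπ using hv
    have hsum : π (∑ i, v i) = 1 := by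
      calc π (∑ i, v i) = ∑ i, Pi.single i ((1 : ∀ i, B i) i) := by
            rw [map_sum]
            exact Finset.sum_congr rfl fun i _ => by rw [hvπ, Pi.one_apply]
        _ = 1 := Finset.univ_sum_single _
    have hmem : ∑ i, v i ∈ I := sum_mem fun i _ => hvI i
    have hnilp : IsNilpotent (1 - ∑ i, v i) := hnil _ (by rw [map_sub, map_one, hsum, sub_self])
    have hunit : IsUnit (∑ i, v i) := by
      have := hnilp.isUnit_one_sub
      rwa [sub_sub_cancel] at this
    obtain ⟨w, hw⟩ := hunit
    apply hI.1
    rw [← TwoSidedIdeal.one_mem_iff]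
    have : (1 : A) = ↑w⁻¹ * ∑ i, v i := by rw [← hw, Units.inv_mul]
    rw [this]
    exact I.mul_mem_left _ _ hmem

end Count

/-! ### From the structure tensor to a bilinear computation -/

section Tensor

variable {A : Type*} [Ring A] [Algebra k A]

/-- A decomposition of the structure tensor of `A` in a basis `b` into `R = R(A)` triads is a
bilinear computation of the multiplication of `A` of length `R` (BCS 1997, (14.7)–(14.8) and
Def. (14.17): the rank of the structural tensor is the rank of the bilinear map).
[cite: BurgisserClausenShokrollahi1997, Def. (14.17)] -/
theorem hasBilComp_of_structureTensor {ι : Type*} [Fintype ι] (b : Module.Basis ι k A) :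
    HasBilComp (LinearMap.mul k A) (tensorRank (structureTensor b)) := by
  classical
  obtain ⟨w, u, v, h⟩ := exists_triad_decomposition_tensorRank (structureTensor b)
  let f : Fin (tensorRank (structureTensor b)) → Module.Dual k A := fun i => ∑ x, u i x • b.coord x
  let g : Fin (tensorRank (structureTensor b)) → Module.Dual k A := fun i => ∑ y, v i y • b.coord y
  let w' : Fin (tensorRank (structureTensor b)) → A := fun i => ∑ z, w i z • b z
  have hf : ∀ i x, f i (b x) = u i x := fun i x => by
    simp [f, Finsupp.single_apply]
  have hg : ∀ i y, g i (b y) = v i y := fun i y => by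
    simp [g, Finsupp.single_apply]
  let ψ : A →ₗ[k] A →ₗ[k] A :=
    ∑ i, ((LinearMap.mul k k).compl₁₂ (f i) (g i)).compr₂ (LinearMap.toSpanSingleton k A (w' i))
  have hψ : ∀ X Y, ψ X Y = ∑ i, (f i X * g i Y) • w' i := fun X Y => by
    simp only [ψ, LinearMap.coe_sum, Finset.sum_apply, LinearMap.compr₂_apply,
      LinearMap.compl₁₂_apply, LinearMap.mul_apply', LinearMap.toSpanSingleton_apply]
  have hmulψ : LinearMap.mul k A = ψ := by
    refine b.ext fun x => b.ext fun y => ?_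
    rw [hψ, LinearMap.mul_apply']
    simp_rw [hf, hg]
    calc b x * b y = ∑ z, b.repr (b x * b y) z • b z := (b.sum_repr _).symm
      _ = ∑ z, (∑ i, w i z * u i x * v i y) • b z := by
          refine Finset.sum_congr rfl fun z _ => ?_
          have hz := congr_fun (congr_fun (congr_fun h z) x) y
          rw [← structureTensor_apply, hz]
          simp [Finset.sum_apply, triad_apply]
      _ = ∑ i, (u i x * v i y) • w' i := by
          simp only [w', Finset.smul_sum, smul_smul, Finset.sum_smul]
          rw [Finset.sum_comm]
          refine Finset.sum_congr rfl fun z _ => Finset.sum_congr rfl fun i _ => ?_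
          congr 1
          ring
  exact ⟨_, le_rfl, ⟨⟨f, g, w', fun X Y => by rw [hmulψ, hψ]⟩⟩⟩

end Tensor

end AlderStrassen1981

open AlderStrassen1981 in
/-- **Alder–Strassen 1981 = BCS 1997, Thm. (17.14), rank form** (discharge of
`AlderStrassen1981_rank`): for a finite-dimensional unital associative algebra `A` over a field
`k` with exactly `t` maximal two-sided ideals and any basis `b`, `2 dim A ≤ R(A) + t`.
Proof as printed (BCS pp. 495–500), run for bilinear computations: `R(A) ≥ R(A/Rad A) + 2 dim Rad A`
(Cor. (17.21)), `A/Rad A ≅ ∏ Mat_{d_i}(D_i)` (Wedderburn–Artin, Fact (17.19)),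
`R(A₁ × B) ≥ 2 dim A₁ − 1 + R(B)` for simple `A₁` (Prop. (17.23)) by induction, and `t` = number
of simple factors (Fact (17.19)(3)). [cite: BurgisserClausenShokrollahi1997, Thm. (17.14)]
[cite: AlderStrassen1981, Thm.] -/
theorem AlderStrassen1981_rank_holds : AlderStrassen1981_rank := by
  intro k _ A _ _ _ ι _ b
  classical
  -- a bilinear computation of length `R(A)`
  obtain ⟨n, hn, ⟨β⟩⟩ := hasBilComp_of_structureTensor b
  -- the radical
  haveI : IsArtinianRing A := IsArtinianRing.of_finite k A
  have hJ : IsNilpotent (Ring.jacobson A) := IsSemiprimaryRing.isNilpotent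
  obtain ⟨r₁, hr₁, h₁⟩ := hasBilComp_quotient β (Ring.jacobson A) hJ
  rw [Fintype.card_fin] at hr₁
  -- Wedderburn–Artin for `A / Rad A`
  haveI : Module.Finite k (A ⧸ Ring.jacobson A) :=
    Module.Finite.of_surjective (Ideal.Quotient.mkₐ k (Ring.jacobson A)).toLinearMap
      (Ideal.Quotient.mkₐ_surjective k _)
  obtain ⟨s, D, d, _, _, _, hd, ⟨e⟩⟩ :=
    IsSemisimpleRing.exists_algEquiv_pi_matrix_divisionRing_finite k (A ⧸ Ring.jacobson A)
  haveI : ∀ i, NeZero (d i) := hd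
  have hpi := main_pi s d D hd r₁ (h₁.of_algEquiv e)
  -- dimensions
  have hdimQ := e.toLinearEquiv.finrank_eq
  have hdimA : finrank k (A ⧸ Ring.jacobson A) +
      finrank k ((Ring.jacobson A).restrictScalars k) = finrank k A := by
    rw [← Submodule.finrank_quotient_add_finrank ((Ring.jacobson A).restrictScalars k)]
    rfl
  -- the count of maximal two-sided ideals
  have hcount : numMaximalTwoSidedIdeals A = s := by
    let π : A →+* (∀ i, Matrix (Fin (d i)) (Fin (d i)) (D i)) :=
      e.toRingEquiv.toRingHom.comp (Ideal.Quotient.mk (Ring.jacobson A))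
    have hπ : ∀ x, π x = e (Ideal.Quotient.mk (Ring.jacobson A) x) := fun x => rfl
    have hπs : Function.Surjective π := fun y => by
      obtain ⟨x, hx⟩ := Ideal.Quotient.mk_surjective (I := Ring.jacobson A) (e.symm y)
      exact ⟨x, by rw [hπ, hx, AlgEquiv.apply_symm_apply]⟩
    refine card_coatoms_eq π hπs fun x hx => ?_
    have hx' : Ideal.Quotient.mk (Ring.jacobson A) x = 0 :=
      e.injective (by rw [map_zero, ← hπ]; exact hx)
    obtain ⟨m, hm⟩ := hJ
    exact ⟨m, Ideal.pow_eq_zero_of_mem hm le_rfl (Ideal.Quotient.eq_zero_iff_mem.1 hx')⟩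
  rw [hcount]
  omega

end Literature.Computability.AlgebraicComplexity

end
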